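import Literature.NumberTheory.EllipticCurves.PAdicOneVariableNormCoherentUnitMomentsTwo
import Literature.NumberTheory.EllipticCurves.PAdicOneVariableNormCoherentUnitComapEquivariantTwo
import Literature.NumberTheory.EllipticCurves.PadicTwoEquivarianceOfComparison
import HarnessLib

/-!
# `F = ℚ₂`: the log-free measures of the norm-coherent units — support, moments, Galois equivariance and the
# `U_0`-equivariance of the pull-back, with the hypotheses of the generic `p = 2` files DISCHARGED for Mathlib's
# `ℚ_[2]` and the canonical `θ : ℂ_{ℚ₂} ≃ ℂ_[2]`

Topic `NumberTheory/EllipticCurves`; namespace `Literature.NumberTheory.EllipticCurves.PadicTwo`.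

De Shalit, *Iwasawa theory of elliptic curves with complex multiplication* (1987), I.3.3 (7)–(7′), I.3.4 (10) and
Lemma (ii), I.3.5 (11), for a norm-coherent unit `β ∈ 𝒰` of the Lubin–Tate tower of `f' = π'X + X²`, `π' = 2u`, over
`K_𝔭 = ℚ₂`.  The generic files (`PAdicOneVariableNormCoherentUnitMomentsTwo.lean`,
`…NormCoherentUnitEquivarianceTwo.lean`, `…NormCoherentUnitComapEquivariantTwo.lean`, cf2c-w4 g6) take a local field `F`
with `|𝓀_F| = 2` and `2` a uniformiser, a continuous ring map `θ : ℂ_F → ℂ_[2]` of norm `≤ 1` on `𝒪_{ℂ_F}` reaching the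
`2`-power roots of unity, resp. a coefficient map `Θ : 𝐃 → 𝕜` with `Θ ∘ ι = padicIntCast ∘ e`.  Here, as in
`PadicTwoSupportOfColemanTrace.lean` / `PadicTwoEquivarianceOfComparison.lean`: `F := ℚ_[2]`
(`Padic.isNonarchimedeanLocalField_holds`, `Padic.residueFieldCard_eq`, `Padic.isUniformizer_natCast`),
`θ := CompletedAlgClosure.equivPadicComplex 2` (its three hypotheses are `PadicTwo.continuous_equivPadicComplex_toRingHom`,
`norm_equivPadicComplex_coe_cBall_le_one`, `exists_pow_two_pow_eq_one_equivPadicComplex_eq`) and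
`Θ := θ ∘ subtype ∘ algebraMap (UnrCoeff ℚ_[2]) (CBall ℚ_[2])` (`theta_intToUnrCoeff_eq_padicIntCast`), for every
`e : 𝒪[ℚ_[2]] → ℤ_[2]` which is the identity on `ℚ_[2]`:

* ★★★ `invAmice₁_μ_eq_zero_normCoherentUnits` — `D_{θ((δβ)~∘ϑ)}` vanishes on every non-unit class ((7′));
* ★★★ `integral_comap_ltCharacter_pow_succ_normCoherentUnits` — (10)+(11):
  `∫_{Γ_{ℚ₂}} 𝟙_{U_0} κ^{k+1} d(comap (restrictUnits (x⁻¹·D)) ψ) = [S^0] D^k (θ((δβ)~∘ϑ))`;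
* ★★★ `restrictUnits_density_unitInv_μ_unitMul_normCoherentUnits_galAct` — Lemma I.3.4 (ii): `ν_{σβ}♭(v̄ b) = ν_β♭(b)`;
* ★★★ `comap_μ_proj_mul_normCoherentUnits` — the `U_0`-equivariance of the pulled-back family (hypothesis `hD` of
  `GroupDistribution.induce`).

Everything is proved; no named facts, no definitions, no instances (the section-local instance attributes of the
siblings), no `sorry`.

## References

* [deShalit1987] E. de Shalit, *Iwasawa theory of elliptic curves with complex multiplication* (1987),
  I.3.3 (7)–(9) (p. 17–18), I.3.4 (10) and Lemma (ii), I.3.5 (11) (p. 18), II.4.6 (14) (p. 59).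
-/

noncomputable section

open MvPowerSeries Filter
open scoped PowerSeries.WithPiTopology Topology Classical

namespace Literature.NumberTheory.EllipticCurves

namespace PadicTwo

open ValuativeRel IsLocalRing Field
open Literature.NumberTheory.GaloisRepresentations Literature.NumberTheory.GaloisRepresentations.IsNonarchimedeanLocalField
  Literature.NumberTheory.GaloisRepresentations.LubinTate Literature.NumberTheory.PAdicHodge

attribute [local instance] ltNormUniformSpace ltNormIsUniformAddGroup rk1 nF nE fintypeResidueField
attribute [local instance] ltTower_U_normal

/-! ### Support and moments ((7′), (10)+(11)) -/

/-- ★★★ **`F = ℚ₂`: the log-free measure of a norm-coherent unit lives on `ℤ₂^×`** — for every uniformiser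
`π' = 2u` of `ℤ₂`, arithmetic Frobenius `σ₀` with Lang unit `ε` and `β ∈ 𝒰` (tower of `f' = π'X + X²`), the
distribution of `H_β := θ((δβ)~ ∘ ϑ) ∈ ℂ_2⟦S⟧` vanishes on every non-unit class of `ℤ/2^{N+1}`.
[cite: deShalit1987, I.3.3 (7)–(7′) (p. 17)] -/
theorem invAmice₁_μ_eq_zero_normCoherentUnits :
    haveI := Padic.isNonarchimedeanLocalField_holds 2
    ∀ {σ₀ : absoluteGaloisGroup ℚ_[2]} (hσ₀ : IsAbsArithFrob σ₀) (u : 𝒪[ℚ_[2]]ˣ)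
      {ε : (maxUnramifiedCompletion ℚ_[2])ˣ}
      (hε : maxUnramifiedCompletion.galAut ℚ_[2] σ₀ (ε : maxUnramifiedCompletion ℚ_[2]) =
        algebraMap 𝒪[ℚ_[2]] (maxUnramifiedCompletion ℚ_[2]) (u : 𝒪[ℚ_[2]]) * (ε : maxUnramifiedCompletion ℚ_[2]))
      (n : ℕ) (β : NormCoherentUnits (isUniformizer_unit_mul (Padic.isUniformizer_natCast 2) u))
      (N : ℕ) (b : ZMod (2 ^ (N + 1))), ¬IsUnit b →
      (invAmice₁ 2 ((PowerSeries.subst ((compSeriesC (Padic.isUniformizer_natCast 2) hσ₀ u hε).map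
            (algebraMap (UnrCoeff ℚ_[2]) (CBall ℚ_[2])))
          ((tildeSer ((u : 𝒪[ℚ_[2]]) * ((2 : ℕ) : 𝒪[ℚ_[2]])) (LTCoeff.of ℚ_[2] (u : 𝒪[ℚ_[2]])) β.logDeriv).map
            ((algebraMap (UnrCoeff ℚ_[2]) (CBall ℚ_[2])).comp
              ((intToUnrCoeff ℚ_[2]).comp (LTCoeff.of ℚ_[2]).symm.toRingHom)))).map
          ((CompletedAlgClosure.equivPadicComplex 2).toRingHom.comp (CBall ℚ_[2]).subtype))
        (norm_coeff_map_le_one _ norm_equivPadicComplex_coe_cBall_le_one _)).μ (N + 1) b = 0 := by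
  haveI := Padic.isNonarchimedeanLocalField_holds 2
  intro σ₀ hσ₀ u ε hε n β N b hb
  exact Literature.NumberTheory.EllipticCurves.invAmice₁_μ_eq_zero_normCoherentUnits (Padic.residueFieldCard_eq 2)
    (Padic.isUniformizer_natCast 2) hσ₀ u hε _ continuous_equivPadicComplex_toRingHom
    norm_equivPadicComplex_coe_cBall_le_one exists_pow_two_pow_eq_one_equivPadicComplex_eq n β N b hb

/-- ★★★ **`F = ℚ₂`: de Shalit's (10)+(11) for a norm-coherent unit** — along the Lubin–Tate tower of `f'` and
`κ = e ∘ χ_{π'}` (`e : 𝒪[ℚ_[2]] ≃ ℤ_[2]`), with `H_β := θ((δβ)~ ∘ ϑ)` and compatible cell maps `ψ`: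
**`∫_{Γ_{ℚ₂}} 𝟙_{U_0}(σ) κ(σ)^{k+1} d(comap (restrictUnits (x⁻¹·D_{H_β})) ψ)(σ) = [S^0] D^k H_β`** for every `k`.
[cite: deShalit1987, I.3.4 (10), I.3.5 (11) (p. 18)] -/
theorem integral_comap_ltCharacter_pow_succ_normCoherentUnits :
    haveI := Padic.isNonarchimedeanLocalField_holds 2
    ∀ {σ₀ : absoluteGaloisGroup ℚ_[2]} (hσ₀ : IsAbsArithFrob σ₀) (u : 𝒪[ℚ_[2]]ˣ)
      {ε : (maxUnramifiedCompletion ℚ_[2])ˣ}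
      (hε : maxUnramifiedCompletion.galAut ℚ_[2] σ₀ (ε : maxUnramifiedCompletion ℚ_[2]) =
        algebraMap 𝒪[ℚ_[2]] (maxUnramifiedCompletion ℚ_[2]) (u : 𝒪[ℚ_[2]]) * (ε : maxUnramifiedCompletion ℚ_[2]))
      (e : 𝒪[ℚ_[2]] ≃+* ℤ_[2])
      (ψ : (n : ℕ) → absoluteGaloisGroup ℚ_[2] ⧸
        (ltTower (isUniformizer_unit_mul (Padic.isUniformizer_natCast 2) u)).U n → ZMod (2 ^ (n + 1)))
      (hψ : ∀ (n : ℕ) (σ : absoluteGaloisGroup ℚ_[2]),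
        σ ∈ (ltTower (isUniformizer_unit_mul (Padic.isUniformizer_natCast 2) u)).U 0 →
        ψ n ((ltTower (isUniformizer_unit_mul (Padic.isUniformizer_natCast 2) u)).proj n σ) = PadicInt.toZModPow (n + 1)
          (((Units.map (e : 𝒪[ℚ_[2]] →+* ℤ_[2]).toMonoidHom).comp
            (lubinTateCharHom (isUniformizer_unit_mul (Padic.isUniformizer_natCast 2) u)) σ : ℤ_[2]ˣ) : ℤ_[2]))
      (n : ℕ) (β : NormCoherentUnits (isUniformizer_unit_mul (Padic.isUniformizer_natCast 2) u)) (k : ℕ),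
      (GroupDistribution.comap (restrictUnits ((invAmice₁ 2
          ((PowerSeries.subst ((compSeriesC (Padic.isUniformizer_natCast 2) hσ₀ u hε).map
              (algebraMap (UnrCoeff ℚ_[2]) (CBall ℚ_[2])))
            ((tildeSer ((u : 𝒪[ℚ_[2]]) * ((2 : ℕ) : 𝒪[ℚ_[2]])) (LTCoeff.of ℚ_[2] (u : 𝒪[ℚ_[2]])) β.logDeriv).map
              ((algebraMap (UnrCoeff ℚ_[2]) (CBall ℚ_[2])).comp
                ((intToUnrCoeff ℚ_[2]).comp (LTCoeff.of ℚ_[2]).symm.toRingHom)))).map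
            ((CompletedAlgClosure.equivPadicComplex 2).toRingHom.comp (CBall ℚ_[2]).subtype))
          (norm_coeff_map_le_one _ norm_equivPadicComplex_coe_cBall_le_one _)).density
          (ProfiniteTower.padicInt_isUniform 2) (unitInv ℂ_[2]) uniformContinuous_unitInv norm_unitInv_le))
          ψ ((ltTower (isUniformizer_unit_mul (Padic.isUniformizer_natCast 2) u)).cellMap_trans _ ψ hψ)
          ((ltTower (isUniformizer_unit_mul (Padic.isUniformizer_natCast 2) u)).cellMap_injective _
            (mem_ltTower_iff (isUniformizer_unit_mul (Padic.isUniformizer_natCast 2) u) e) ψ hψ)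
          ((ltTower (isUniformizer_unit_mul (Padic.isUniformizer_natCast 2) u)).cellMap_fiberSurj _
            (mem_ltTower_iff (isUniformizer_unit_mul (Padic.isUniformizer_natCast 2) u) e)
            (exists_toZModPow_ltCharacter_eq (isUniformizer_unit_mul (Padic.isUniformizer_natCast 2) u) e) ψ hψ)).integral
          (fun σ ↦ (if (ltTower (isUniformizer_unit_mul (Padic.isUniformizer_natCast 2) u)).proj 0 σ = 1
              then (1 : ℂ_[2]) else 0) *
            padicIntCast ℂ_[2]
              ((((Units.map (e : 𝒪[ℚ_[2]] →+* ℤ_[2]).toMonoidHom).comp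
                (lubinTateCharHom (isUniformizer_unit_mul (Padic.isUniformizer_natCast 2) u)) σ : ℤ_[2]ˣ) : ℤ_[2]) ^ (k + 1))) =
        PowerSeries.constantCoeff (mahlerD^[k]
          ((PowerSeries.subst ((compSeriesC (Padic.isUniformizer_natCast 2) hσ₀ u hε).map
              (algebraMap (UnrCoeff ℚ_[2]) (CBall ℚ_[2])))
            ((tildeSer ((u : 𝒪[ℚ_[2]]) * ((2 : ℕ) : 𝒪[ℚ_[2]])) (LTCoeff.of ℚ_[2] (u : 𝒪[ℚ_[2]])) β.logDeriv).map
              ((algebraMap (UnrCoeff ℚ_[2]) (CBall ℚ_[2])).comp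
                ((intToUnrCoeff ℚ_[2]).comp (LTCoeff.of ℚ_[2]).symm.toRingHom)))).map
            ((CompletedAlgClosure.equivPadicComplex 2).toRingHom.comp (CBall ℚ_[2]).subtype))) := by
  haveI := Padic.isNonarchimedeanLocalField_holds 2
  intro σ₀ hσ₀ u ε hε e ψ hψ n β k
  exact Literature.NumberTheory.EllipticCurves.integral_comap_ltCharacter_pow_succ_normCoherentUnits
    (Padic.residueFieldCard_eq 2) (Padic.isUniformizer_natCast 2) hσ₀ u hε _ continuous_equivPadicComplex_toRingHom
    norm_equivPadicComplex_coe_cBall_le_one exists_pow_two_pow_eq_one_equivPadicComplex_eq e ψ hψ n β k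

/-! ### Galois equivariance (Lemma I.3.4 (ii)) and the `U_0`-equivariance of the pull-back -/

/-- ★★★ **`F = ℚ₂`: de Shalit's Lemma I.3.4 (ii) for the log-free measures** — for `σ ∈ Γ_{ℚ₂}`, `β ∈ 𝒰`,
`H_γ := Θ((δγ)~ ∘ ϑ)` read in `ℂ_[2]` through `Θ = θ ∘ ι` and `v := e(χ_{π'}(σ)) ∈ ℤ_2^×` (`e` the identity of
`ℤ₂` on `ℚ₂`): **`ν_{σβ}♭(v̄ b) = ν_β♭(b)`** on the unit cells, `ν_γ♭ = restrictUnits (x⁻¹ · D_{H_γ})`.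
[cite: deShalit1987, I.3.4 Lemma (ii) (p. 18)] -/
theorem restrictUnits_density_unitInv_μ_unitMul_normCoherentUnits_galAct :
    haveI := Padic.isNonarchimedeanLocalField_holds 2
    ∀ {σ₀ : absoluteGaloisGroup ℚ_[2]} (hσ₀ : IsAbsArithFrob σ₀) (u : 𝒪[ℚ_[2]]ˣ)
      {ε : (maxUnramifiedCompletion ℚ_[2])ˣ}
      (hε : maxUnramifiedCompletion.galAut ℚ_[2] σ₀ (ε : maxUnramifiedCompletion ℚ_[2]) =
        algebraMap 𝒪[ℚ_[2]] (maxUnramifiedCompletion ℚ_[2]) (u : 𝒪[ℚ_[2]]) * (ε : maxUnramifiedCompletion ℚ_[2]))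
      (e : 𝒪[ℚ_[2]] →+* ℤ_[2]) (_he : ∀ a : 𝒪[ℚ_[2]], ((e a : ℤ_[2]) : ℚ_[2]) = (a : ℚ_[2]))
      (σ : absoluteGaloisGroup ℚ_[2])
      (β : NormCoherentUnits (isUniformizer_unit_mul (Padic.isUniformizer_natCast 2) u)) {C : ℝ}
      (hC₁ : ∀ k, ‖PowerSeries.coeff k ((PowerSeries.subst (compSeriesC (Padic.isUniformizer_natCast 2) hσ₀ u hε)
        ((tildeSer ((u : 𝒪[ℚ_[2]]) * ((2 : ℕ) : 𝒪[ℚ_[2]])) (LTCoeff.of ℚ_[2] (u : 𝒪[ℚ_[2]])) β.logDeriv).map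
          ((intToUnrCoeff ℚ_[2]).comp (LTCoeff.of ℚ_[2]).symm.toRingHom))).map
        (((CompletedAlgClosure.equivPadicComplex 2).toRingHom.comp (CBall ℚ_[2]).subtype).comp
          (algebraMap (UnrCoeff ℚ_[2]) (CBall ℚ_[2]))))‖ ≤ C)
      (hC₂ : ∀ k, ‖PowerSeries.coeff k ((PowerSeries.subst (compSeriesC (Padic.isUniformizer_natCast 2) hσ₀ u hε)
        ((tildeSer ((u : 𝒪[ℚ_[2]]) * ((2 : ℕ) : 𝒪[ℚ_[2]])) (LTCoeff.of ℚ_[2] (u : 𝒪[ℚ_[2]]))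
          (β.galAct σ).logDeriv).map ((intToUnrCoeff ℚ_[2]).comp (LTCoeff.of ℚ_[2]).symm.toRingHom))).map
        (((CompletedAlgClosure.equivPadicComplex 2).toRingHom.comp (CBall ℚ_[2]).subtype).comp
          (algebraMap (UnrCoeff ℚ_[2]) (CBall ℚ_[2]))))‖ ≤ C)
      (n : ℕ) (b : ZMod (2 ^ (n + 1))),
      (restrictUnits ((invAmice₁ 2 ((PowerSeries.subst (compSeriesC (Padic.isUniformizer_natCast 2) hσ₀ u hε)
          ((tildeSer ((u : 𝒪[ℚ_[2]]) * ((2 : ℕ) : 𝒪[ℚ_[2]])) (LTCoeff.of ℚ_[2] (u : 𝒪[ℚ_[2]]))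
            (β.galAct σ).logDeriv).map ((intToUnrCoeff ℚ_[2]).comp (LTCoeff.of ℚ_[2]).symm.toRingHom))).map
          (((CompletedAlgClosure.equivPadicComplex 2).toRingHom.comp (CBall ℚ_[2]).subtype).comp
            (algebraMap (UnrCoeff ℚ_[2]) (CBall ℚ_[2])))) hC₂).density
          (ProfiniteTower.padicInt_isUniform 2) (unitInv ℂ_[2]) uniformContinuous_unitInv norm_unitInv_le)).μ n
          (BoundedDistribution.unitMul (BoundedDistribution.unitMod (n + 1)
            (Units.map (e : 𝒪[ℚ_[2]] →* ℤ_[2])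
              (lubinTateChar (isUniformizer_unit_mul (Padic.isUniformizer_natCast 2) u) σ))) b) =
        (restrictUnits ((invAmice₁ 2 ((PowerSeries.subst (compSeriesC (Padic.isUniformizer_natCast 2) hσ₀ u hε)
          ((tildeSer ((u : 𝒪[ℚ_[2]]) * ((2 : ℕ) : 𝒪[ℚ_[2]])) (LTCoeff.of ℚ_[2] (u : 𝒪[ℚ_[2]])) β.logDeriv).map
            ((intToUnrCoeff ℚ_[2]).comp (LTCoeff.of ℚ_[2]).symm.toRingHom))).map
          (((CompletedAlgClosure.equivPadicComplex 2).toRingHom.comp (CBall ℚ_[2]).subtype).comp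
            (algebraMap (UnrCoeff ℚ_[2]) (CBall ℚ_[2])))) hC₁).density
          (ProfiniteTower.padicInt_isUniform 2) (unitInv ℂ_[2]) uniformContinuous_unitInv norm_unitInv_le)).μ n b := by
  haveI := Padic.isNonarchimedeanLocalField_holds 2
  intro σ₀ hσ₀ u ε hε e he σ β C hC₁ hC₂ n b
  exact Literature.NumberTheory.EllipticCurves.restrictUnits_density_unitInv_μ_unitMul_normCoherentUnits_galAct
    (Padic.residueFieldCard_eq 2) (Padic.isUniformizer_natCast 2) hσ₀ u hε _ e
    (theta_intToUnrCoeff_eq_padicIntCast e he) σ β hC₁ hC₂ n b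

/-- ★★★ **`F = ℚ₂`: `U_0`-equivariance of the pulled-back log-free measures of the norm-coherent units** (tower of
`f' = π'X + X²`, `π' = 2u`, `κ = e ∘ χ_{π'}` with `e : 𝒪[ℚ_[2]] ≃ ℤ_[2]` the identity on `ℚ₂`): for a
`Γ_{ℚ₂}`-equivariant family `η : B → 𝒰`, `h ∈ U_0`, `b ∈ B` and every level-`n` cell `a ⊆ U_0`,
**`(comap ν_{η(h•b)}♭ ψ)(h̄ · a) = (comap ν_{η b}♭ ψ)(a)`** — the hypothesis `hD` of `GroupDistribution.induce`.
[cite: deShalit1987, I.3.4 Lemma (ii) (p. 18), II.4.6 (14) (p. 59)] -/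
theorem comap_μ_proj_mul_normCoherentUnits :
    haveI := Padic.isNonarchimedeanLocalField_holds 2
    ∀ {σ₀ : absoluteGaloisGroup ℚ_[2]} (hσ₀ : IsAbsArithFrob σ₀) (u : 𝒪[ℚ_[2]]ˣ)
      {ε : (maxUnramifiedCompletion ℚ_[2])ˣ}
      (hε : maxUnramifiedCompletion.galAut ℚ_[2] σ₀ (ε : maxUnramifiedCompletion ℚ_[2]) =
        algebraMap 𝒪[ℚ_[2]] (maxUnramifiedCompletion ℚ_[2]) (u : 𝒪[ℚ_[2]]) * (ε : maxUnramifiedCompletion ℚ_[2]))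
      (e : 𝒪[ℚ_[2]] ≃+* ℤ_[2]) (_he : ∀ a : 𝒪[ℚ_[2]], (((e : 𝒪[ℚ_[2]] →+* ℤ_[2]) a : ℤ_[2]) : ℚ_[2]) = (a : ℚ_[2]))
      {B : Type*} [SMul (absoluteGaloisGroup ℚ_[2]) B]
      (η : B → NormCoherentUnits (isUniformizer_unit_mul (Padic.isUniformizer_natCast 2) u))
      (_hη : ∀ (σ : absoluteGaloisGroup ℚ_[2]) (b : B), η (σ • b) = (η b).galAct σ)
      {C : ℝ}
      (hC : ∀ (b : B) (k : ℕ), ‖PowerSeries.coeff k ((PowerSeries.subst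
        (compSeriesC (Padic.isUniformizer_natCast 2) hσ₀ u hε)
        ((tildeSer ((u : 𝒪[ℚ_[2]]) * ((2 : ℕ) : 𝒪[ℚ_[2]])) (LTCoeff.of ℚ_[2] (u : 𝒪[ℚ_[2]])) (η b).logDeriv).map
          ((intToUnrCoeff ℚ_[2]).comp (LTCoeff.of ℚ_[2]).symm.toRingHom))).map
        (((CompletedAlgClosure.equivPadicComplex 2).toRingHom.comp (CBall ℚ_[2]).subtype).comp
          (algebraMap (UnrCoeff ℚ_[2]) (CBall ℚ_[2]))))‖ ≤ C)
      (ψ : (n : ℕ) → absoluteGaloisGroup ℚ_[2] ⧸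
        (ltTower (isUniformizer_unit_mul (Padic.isUniformizer_natCast 2) u)).U n → ZMod (2 ^ (n + 1)))
      (hψ : ∀ (n : ℕ) (σ : absoluteGaloisGroup ℚ_[2]),
        σ ∈ (ltTower (isUniformizer_unit_mul (Padic.isUniformizer_natCast 2) u)).U 0 →
        ψ n ((ltTower (isUniformizer_unit_mul (Padic.isUniformizer_natCast 2) u)).proj n σ) = PadicInt.toZModPow (n + 1)
          (((Units.map (e : 𝒪[ℚ_[2]] →+* ℤ_[2]).toMonoidHom).comp
            (lubinTateCharHom (isUniformizer_unit_mul (Padic.isUniformizer_natCast 2) u)) σ : ℤ_[2]ˣ) : ℤ_[2])),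
    ∀ h ∈ (ltTower (isUniformizer_unit_mul (Padic.isUniformizer_natCast 2) u)).U 0, ∀ (b : B) (n : ℕ)
      (a : absoluteGaloisGroup ℚ_[2] ⧸ (ltTower (isUniformizer_unit_mul (Padic.isUniformizer_natCast 2) u)).U n),
      (ltTower (isUniformizer_unit_mul (Padic.isUniformizer_natCast 2) u)).transLE (Nat.zero_le n) a = 1 →
      (GroupDistribution.comap (restrictUnits ((invAmice₁ 2 ((PowerSeries.subst
          (compSeriesC (Padic.isUniformizer_natCast 2) hσ₀ u hε)
          ((tildeSer ((u : 𝒪[ℚ_[2]]) * ((2 : ℕ) : 𝒪[ℚ_[2]])) (LTCoeff.of ℚ_[2] (u : 𝒪[ℚ_[2]]))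
            (η (h • b)).logDeriv).map ((intToUnrCoeff ℚ_[2]).comp (LTCoeff.of ℚ_[2]).symm.toRingHom))).map
          (((CompletedAlgClosure.equivPadicComplex 2).toRingHom.comp (CBall ℚ_[2]).subtype).comp
            (algebraMap (UnrCoeff ℚ_[2]) (CBall ℚ_[2])))) (hC (h • b))).density
          (ProfiniteTower.padicInt_isUniform 2) (unitInv ℂ_[2]) uniformContinuous_unitInv norm_unitInv_le))
          ψ ((ltTower (isUniformizer_unit_mul (Padic.isUniformizer_natCast 2) u)).cellMap_trans _ ψ hψ)
          ((ltTower (isUniformizer_unit_mul (Padic.isUniformizer_natCast 2) u)).cellMap_injective _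
            (mem_ltTower_iff (isUniformizer_unit_mul (Padic.isUniformizer_natCast 2) u) e) ψ hψ)
          ((ltTower (isUniformizer_unit_mul (Padic.isUniformizer_natCast 2) u)).cellMap_fiberSurj _
            (mem_ltTower_iff (isUniformizer_unit_mul (Padic.isUniformizer_natCast 2) u) e)
            (exists_toZModPow_ltCharacter_eq (isUniformizer_unit_mul (Padic.isUniformizer_natCast 2) u) e) ψ hψ)).μ n
          ((ltTower (isUniformizer_unit_mul (Padic.isUniformizer_natCast 2) u)).proj n h * a) =
        (GroupDistribution.comap (restrictUnits ((invAmice₁ 2 ((PowerSeries.subst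
          (compSeriesC (Padic.isUniformizer_natCast 2) hσ₀ u hε)
          ((tildeSer ((u : 𝒪[ℚ_[2]]) * ((2 : ℕ) : 𝒪[ℚ_[2]])) (LTCoeff.of ℚ_[2] (u : 𝒪[ℚ_[2]])) (η b).logDeriv).map
            ((intToUnrCoeff ℚ_[2]).comp (LTCoeff.of ℚ_[2]).symm.toRingHom))).map
          (((CompletedAlgClosure.equivPadicComplex 2).toRingHom.comp (CBall ℚ_[2]).subtype).comp
            (algebraMap (UnrCoeff ℚ_[2]) (CBall ℚ_[2])))) (hC b)).density
          (ProfiniteTower.padicInt_isUniform 2) (unitInv ℂ_[2]) uniformContinuous_unitInv norm_unitInv_le))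
          ψ ((ltTower (isUniformizer_unit_mul (Padic.isUniformizer_natCast 2) u)).cellMap_trans _ ψ hψ)
          ((ltTower (isUniformizer_unit_mul (Padic.isUniformizer_natCast 2) u)).cellMap_injective _
            (mem_ltTower_iff (isUniformizer_unit_mul (Padic.isUniformizer_natCast 2) u) e) ψ hψ)
          ((ltTower (isUniformizer_unit_mul (Padic.isUniformizer_natCast 2) u)).cellMap_fiberSurj _
            (mem_ltTower_iff (isUniformizer_unit_mul (Padic.isUniformizer_natCast 2) u) e)
            (exists_toZModPow_ltCharacter_eq (isUniformizer_unit_mul (Padic.isUniformizer_natCast 2) u) e) ψ hψ)).μ n a := by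
  haveI := Padic.isNonarchimedeanLocalField_holds 2
  intro σ₀ hσ₀ u ε hε e he B _ η hη C hC ψ hψ
  exact Literature.NumberTheory.EllipticCurves.comap_μ_proj_mul_normCoherentUnits (Padic.residueFieldCard_eq 2)
    (Padic.isUniformizer_natCast 2) hσ₀ u hε _ e (theta_intToUnrCoeff_eq_padicIntCast (e : 𝒪[ℚ_[2]] →+* ℤ_[2]) he)
    η hη hC ψ hψ

end PadicTwo

end Literature.NumberTheory.EllipticCurves

end
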